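import Mathlib
import Summits.MatrixMultiplication.MatrixMultiplication.Theorems.SubgroupIdentityDesigns.Negative.Fixers
import Summits.MatrixMultiplication.MatrixMultiplication.Theorems.SubgroupIdentityDesigns.Negative.LineCertificate
import Summits.MatrixMultiplication.MatrixMultiplication.Theorems.SubgroupIdentityDesigns.Negative.SingerCycleOrder

/-!
# Large `p`-free members: `|H Z / Z| > p + 1` and `p ∤ |H|` kill every level-one design (all `p`)

Route `LevelGradedCohnUmans`, crux `SubgroupIdentityDesigns`, the `(m,k) = (2,1)` cell.

**Theorem** (`no_levelOne_design_of_large_pfree_mem₁/₂/₃`).  Let `(H₁, H₂, H₃)` be subgroups of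
`GL₂(𝔽_p)` whose scalar parts cover the centre (`S₁ S₂ S₃ = Z`, e.g. `scalar_cover` for a
subgroup-TPP triple with `|S₁||S₂||S₃| = p - 1`), and let some member `Hᵢ ≥ H` with `p ∤ |H|` and
projective image `|H Z / Z| > p + 1`.  Then the triple carries NO level-one identity design — for
every prime `p`, with no TPP and no volume hypothesis.

Proof.  `K = H Z` (the preimage of `H Z / Z`) has `|K| = (p-1)·|H Z / Z| > p² - 1` elements and
`p ∤ |K|`; its non-identity elements are triple products `a b g ∈ H₁ H₂ H₃` (write the scalar
factor as `s₁ s₂ s₃` and absorb `sᵢ` into the member containing `H`; scalars are central).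
PIGEONHOLE (`exists_fixer_of_card_gt`): for `a ≠ 0` the orbit map `k ↦ k a` sends the `> p² - 1`
elements of `K` into the `p² - 1` non-zero vectors, so `Stab_K(a) ≠ 1`.  Now the faithful
determinant character of `Fixers` (`sum_stab_faithful_eq_zero`: a unimodular `p`-free fixer is
trivial, so `det` is non-trivial on every stabiliser) is a coset certificate on `K`, and
`no_levelOne_design_of_coset_certificate` (product-set form) closes.

This is the engine that discharges the last residual profile of the `(2,1)` cell
(`p = 31`, `E·Z` with `|E Z / Z| = 60 > 32`, `31 ∤ 120`; file `CellTwoOneEmpty`).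
VALUE = THEOREM, NOT summit progress; the crux item stmt-MatrixMultiplication-14079 is untouched and
remains open.
-/

set_option linter.dupNamespace false

noncomputable section

open scoped BigOperators Classical

open Summit.MatrixMultiplication.MatrixMultiplication.Theorems.LieRankDesigns.Negative (GLm Mat)

namespace Summit.MatrixMultiplication.MatrixMultiplication.Theorems.SubgroupIdentityDesigns.Negative

section LargePfreeMember

variable {p : ℕ} [hp : Fact p.Prime]

/-! ## Pigeonhole fixers and the product-set form of the fixers criterion -/

/-- **Pigeonhole fixers.**  A subgroup `K ≤ GL₂(𝔽_p)` with more than `p² - 1` elements fixes every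
non-zero vector non-trivially: `k ↦ k a` maps `K` into the non-zero vectors, so two distinct
`k ≠ k'` agree at `a` and `k'⁻¹ k ∈ Stab_K(a) ∖ 1`. -/
theorem exists_fixer_of_card_gt (K : Subgroup (GLm p 2)) (hbig : p ^ 2 - 1 < Nat.card K)
    (a : Fin 2 → ZMod p) (ha : a ≠ 0) :
    ∃ s ∈ K, s ≠ 1 ∧ ((s : GLm p 2) : Mat p 2).mulVec a = a := by
  let φ : K → {v : Fin 2 → ZMod p // v ≠ 0} :=
    fun k => ⟨((k : GLm p 2) : Mat p 2).mulVec a, gl2_mulVec_ne_zero _ ha⟩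
  have hcard : Fintype.card {v : Fin 2 → ZMod p // v ≠ 0} < Fintype.card K := by
    have h1 : Fintype.card {v : Fin 2 → ZMod p // v ≠ 0} < Fintype.card (Fin 2 → ZMod p) :=
      Fintype.card_subtype_lt (p := fun v : Fin 2 → ZMod p => v ≠ 0) (x := 0) (by simp)
    have h2 : Fintype.card (Fin 2 → ZMod p) = p ^ 2 := by
      rw [Fintype.card_fun, ZMod.card, Fintype.card_fin]
    rw [← Nat.card_eq_fintype_card (α := K)]
    omega
  obtain ⟨k, k', hne, hkk'⟩ := Fintype.exists_ne_map_eq_of_card_lt φ hcard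
  have hv : ((k : GLm p 2) : Mat p 2).mulVec a = ((k' : GLm p 2) : Mat p 2).mulVec a :=
    congrArg Subtype.val hkk'
  refine ⟨((k'⁻¹ * k : K) : GLm p 2), (k'⁻¹ * k).2, ?_, ?_⟩
  · intro h
    apply hne
    have h' : k'⁻¹ * k = 1 := Subtype.ext (by rw [h, Subgroup.coe_one])
    rw [inv_mul_eq_one] at h'
    exact h'.symm
  · rw [Subgroup.coe_mul, Subgroup.coe_inv, Units.val_mul, ← Matrix.mulVec_mulVec, hv,
      Matrix.mulVec_mulVec, ← Units.val_mul, inv_mul_cancel, Units.val_one, Matrix.one_mulVec]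

/-- **NON-TRIVIAL FIXERS ⇒ NO LEVEL-ONE IDENTITY DESIGN, product-set form.**  `K` a subgroup whose
non-identity elements are triple products `a b g ∈ H₁ H₂ H₃`, `p ∤ |K|`, and every non-zero vector
is fixed by some `k ∈ K ∖ 1` ⇒ no design.  All `p`, no TPP; generalises
`no_levelOne_design_of_fixers_memᵢ` (`K ≤ Hᵢ`). -/
theorem no_levelOne_design_of_fixers_prod {H₁ H₂ H₃ : Subgroup (GLm p 2)}
    (K : Subgroup (GLm p 2))
    (hmem : ∀ k ∈ K, k ≠ 1 → ∃ a ∈ H₁, ∃ b ∈ H₂, ∃ g ∈ H₃, a * b * g = k)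
    (hKp : ¬ p ∣ Nat.card K)
    (hfix : ∀ a : Fin 2 → ZMod p, a ≠ 0 →
      ∃ s ∈ K, s ≠ 1 ∧ ((s : GLm p 2) : Mat p 2).mulVec a = a) :
    ¬ ∃ c : Mat p 2 → ℂ, (∀ M, 1 < M.rank → c M = 0) ∧
      (∑ M, c M * ZMod.stdAddChar (Matrix.trace (M * ((1 : GLm p 2) : Mat p 2)))) = 1 ∧
      ∀ a ∈ H₁, ∀ b ∈ H₂, ∀ g ∈ H₃, a * b * g ≠ 1 →
        (∑ M, c M *
          ZMod.stdAddChar (Matrix.trace (M * ((a * b * g : GLm p 2) : Mat p 2)))) = 0 := by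
  obtain ⟨η, hη1, hmul, hfaith⟩ := exists_faithful_detChar (p := p)
  exact no_levelOne_design_of_coset_certificate K η (by rw [hη1]; exact one_ne_zero)
    (coset_weight_of_character K η (fun k _ s _ => hmul k s)
      (fun a ha => sum_stab_faithful_eq_zero K hKp η hη1 hmul hfaith a ha (hfix a ha)))
    hmem

/-- **LARGE `p`-FREE SUBGROUP OF THE PRODUCT SET ⇒ NO LEVEL-ONE IDENTITY DESIGN.**  `K ∖ 1 ⊆
H₁ H₂ H₃` (as triple products), `p ∤ |K|`, `|K| > p² - 1` ⇒ no design.  All `p`, no TPP. -/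
theorem no_levelOne_design_of_large_pfree_prod {H₁ H₂ H₃ : Subgroup (GLm p 2)}
    (K : Subgroup (GLm p 2))
    (hmem : ∀ k ∈ K, k ≠ 1 → ∃ a ∈ H₁, ∃ b ∈ H₂, ∃ g ∈ H₃, a * b * g = k)
    (hKp : ¬ p ∣ Nat.card K) (hbig : p ^ 2 - 1 < Nat.card K) :
    ¬ ∃ c : Mat p 2 → ℂ, (∀ M, 1 < M.rank → c M = 0) ∧
      (∑ M, c M * ZMod.stdAddChar (Matrix.trace (M * ((1 : GLm p 2) : Mat p 2)))) = 1 ∧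
      ∀ a ∈ H₁, ∀ b ∈ H₂, ∀ g ∈ H₃, a * b * g ≠ 1 →
        (∑ M, c M *
          ZMod.stdAddChar (Matrix.trace (M * ((a * b * g : GLm p 2) : Mat p 2)))) = 0 :=
  no_levelOne_design_of_fixers_prod K hmem hKp (fun a ha => exists_fixer_of_card_gt K hbig a ha)

/-! ## The scalar extension `H Z` of a subgroup -/

/-- Membership in `H Z = π⁻¹(π H)` (`π : GL₂ → GL₂/Z`): `x ∈ H Z ↔ x = h · (u·1)` for some
`h ∈ H`, `u ∈ 𝔽_pˣ`. -/
theorem mem_comap_map_mk_iff (H : Subgroup (GLm p 2)) (x : GLm p 2) :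
    x ∈ (H.map (QuotientGroup.mk' (scalarHom p 2).range)).comap
        (QuotientGroup.mk' (scalarHom p 2).range) ↔
      ∃ h ∈ H, ∃ u : (ZMod p)ˣ, x = h * scalarHom p 2 u := by
  rw [Subgroup.mem_comap, Subgroup.mem_map]
  constructor
  · rintro ⟨h, hh, hhx⟩
    rw [QuotientGroup.mk'_apply, QuotientGroup.mk'_apply, QuotientGroup.eq] at hhx
    obtain ⟨u, hu⟩ := hhx
    exact ⟨h, hh, u, by rw [hu, mul_inv_cancel_left]⟩
  · rintro ⟨h, hh, u, rfl⟩
    refine ⟨h, hh, ?_⟩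
    rw [QuotientGroup.mk'_apply, QuotientGroup.mk'_apply, QuotientGroup.eq, inv_mul_cancel_left]
    exact ⟨u, rfl⟩

/-- Every scalar lies in `H Z`: the scalar part of `H Z` is all of `𝔽_pˣ`. -/
theorem comap_scalarHom_comap_map_mk (H : Subgroup (GLm p 2)) :
    ((H.map (QuotientGroup.mk' (scalarHom p 2).range)).comap
        (QuotientGroup.mk' (scalarHom p 2).range)).comap (scalarHom p 2) = ⊤ := by
  rw [eq_top_iff]
  intro u _
  rw [Subgroup.mem_comap, mem_comap_map_mk_iff]
  exact ⟨1, H.one_mem, u, by rw [one_mul]⟩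

/-- `|H Z| = (p - 1) · |H Z / Z|`. -/
theorem card_comap_map_mk (H : Subgroup (GLm p 2)) :
    Nat.card ((H.map (QuotientGroup.mk' (scalarHom p 2).range)).comap
        (QuotientGroup.mk' (scalarHom p 2).range)) =
      (p - 1) * Nat.card (H.map (QuotientGroup.mk' (scalarHom p 2).range)) := by
  rw [card_eq_scalar_mul_card_image
      ((H.map (QuotientGroup.mk' (scalarHom p 2).range)).comap
        (QuotientGroup.mk' (scalarHom p 2).range)),
    comap_scalarHom_comap_map_mk, Subgroup.card_top, Nat.card_eq_fintype_card, ZMod.card_units,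
    Subgroup.map_comap_eq_self_of_surjective (QuotientGroup.mk'_surjective _)]

/-- `p ∤ |H| ⇒ p ∤ |H Z|` (`|H Z / Z|` divides `|H|`, and `p ∤ p - 1`). -/
theorem not_dvd_card_comap_map_mk (H : Subgroup (GLm p 2)) (hHp : ¬ p ∣ Nat.card H) :
    ¬ p ∣ Nat.card ((H.map (QuotientGroup.mk' (scalarHom p 2).range)).comap
        (QuotientGroup.mk' (scalarHom p 2).range)) := by
  rw [card_comap_map_mk, hp.out.dvd_mul, not_or]
  refine ⟨fun h => ?_, fun h => hHp (h.trans (Subgroup.card_map_dvd H _))⟩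
  have h2 := hp.out.two_le
  have h3 := Nat.le_of_dvd (by omega) h
  omega

/-- `|H Z / Z| > p + 1 ⇒ |H Z| > p² - 1` (`p² - 1 = (p-1)(p+1)`). -/
theorem card_comap_map_mk_gt (H : Subgroup (GLm p 2))
    (hbig : p + 1 < Nat.card (H.map (QuotientGroup.mk' (scalarHom p 2).range))) :
    p ^ 2 - 1 < Nat.card ((H.map (QuotientGroup.mk' (scalarHom p 2).range)).comap
        (QuotientGroup.mk' (scalarHom p 2).range)) := by
  rw [card_comap_map_mk]
  have h1 : p ^ 2 - 1 = (p - 1) * (p + 1) := by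
    have h1p : 1 ≤ p := hp.out.one_lt.le
    zify [h1p, Nat.one_le_pow 2 p hp.out.pos]
    ring
  rw [h1]
  exact mul_lt_mul_of_pos_left hbig (by have := hp.out.two_le; omega)

/-! ## Scalar cover: `H Z ∖ 1 ⊆ H₁ H₂ H₃` when `H` sits in a member -/

/-- `H ≤ H₁` and `S₁ S₂ S₃ = Z` ⇒ every element of `H Z` is a product `a b g ∈ H₁ H₂ H₃`. -/
theorem prod_mem_of_cover₁ {H₁ H₂ H₃ : Subgroup (GLm p 2)} (H : Subgroup (GLm p 2)) (hHK : H ≤ H₁)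
    (hcover : ∀ z ∈ (scalarHom p 2).range, ∃ s₁ ∈ H₁ ⊓ (scalarHom p 2).range,
      ∃ s₂ ∈ H₂ ⊓ (scalarHom p 2).range, ∃ s₃ ∈ H₃ ⊓ (scalarHom p 2).range, s₁ * s₂ * s₃ = z) :
    ∀ k ∈ (H.map (QuotientGroup.mk' (scalarHom p 2).range)).comap
        (QuotientGroup.mk' (scalarHom p 2).range),
      k ≠ 1 → ∃ a ∈ H₁, ∃ b ∈ H₂, ∃ g ∈ H₃, a * b * g = k := by
  intro k hk _
  obtain ⟨h, hh, u, rfl⟩ := (mem_comap_map_mk_iff H k).mp hk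
  obtain ⟨s₁, ⟨hs₁, -⟩, s₂, ⟨hs₂, -⟩, s₃, ⟨hs₃, -⟩, hprod⟩ := hcover (scalarHom p 2 u) ⟨u, rfl⟩
  refine ⟨h * s₁, H₁.mul_mem (hHK hh) hs₁, s₂, hs₂, s₃, hs₃, ?_⟩
  rw [← hprod]
  simp only [mul_assoc]

/-- `H ≤ H₂` and `S₁ S₂ S₃ = Z` ⇒ every element of `H Z` is a product `a b g ∈ H₁ H₂ H₃`
(scalars are central). -/
theorem prod_mem_of_cover₂ {H₁ H₂ H₃ : Subgroup (GLm p 2)} (H : Subgroup (GLm p 2)) (hHK : H ≤ H₂)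
    (hcover : ∀ z ∈ (scalarHom p 2).range, ∃ s₁ ∈ H₁ ⊓ (scalarHom p 2).range,
      ∃ s₂ ∈ H₂ ⊓ (scalarHom p 2).range, ∃ s₃ ∈ H₃ ⊓ (scalarHom p 2).range, s₁ * s₂ * s₃ = z) :
    ∀ k ∈ (H.map (QuotientGroup.mk' (scalarHom p 2).range)).comap
        (QuotientGroup.mk' (scalarHom p 2).range),
      k ≠ 1 → ∃ a ∈ H₁, ∃ b ∈ H₂, ∃ g ∈ H₃, a * b * g = k := by
  intro k hk _
  obtain ⟨h, hh, u, rfl⟩ := (mem_comap_map_mk_iff H k).mp hk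
  obtain ⟨s₁, ⟨hs₁, ⟨v, rfl⟩⟩, s₂, ⟨hs₂, -⟩, s₃, ⟨hs₃, -⟩, hprod⟩ :=
    hcover (scalarHom p 2 u) ⟨u, rfl⟩
  refine ⟨scalarHom p 2 v, hs₁, h * s₂, H₂.mul_mem (hHK hh) hs₂, s₃, hs₃, ?_⟩
  rw [← hprod, ← mul_assoc, ← mul_assoc, scalarHom_comm v h]
  simp only [mul_assoc]

/-- `H ≤ H₃` and `S₁ S₂ S₃ = Z` ⇒ every element of `H Z` is a product `a b g ∈ H₁ H₂ H₃`
(scalars are central). -/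
theorem prod_mem_of_cover₃ {H₁ H₂ H₃ : Subgroup (GLm p 2)} (H : Subgroup (GLm p 2)) (hHK : H ≤ H₃)
    (hcover : ∀ z ∈ (scalarHom p 2).range, ∃ s₁ ∈ H₁ ⊓ (scalarHom p 2).range,
      ∃ s₂ ∈ H₂ ⊓ (scalarHom p 2).range, ∃ s₃ ∈ H₃ ⊓ (scalarHom p 2).range, s₁ * s₂ * s₃ = z) :
    ∀ k ∈ (H.map (QuotientGroup.mk' (scalarHom p 2).range)).comap
        (QuotientGroup.mk' (scalarHom p 2).range),
      k ≠ 1 → ∃ a ∈ H₁, ∃ b ∈ H₂, ∃ g ∈ H₃, a * b * g = k := by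
  intro k hk _
  obtain ⟨h, hh, u, rfl⟩ := (mem_comap_map_mk_iff H k).mp hk
  obtain ⟨s₁, ⟨hs₁, ⟨v₁, rfl⟩⟩, s₂, ⟨hs₂, ⟨v₂, rfl⟩⟩, s₃, ⟨hs₃, -⟩, hprod⟩ :=
    hcover (scalarHom p 2 u) ⟨u, rfl⟩
  refine ⟨scalarHom p 2 v₁, hs₁, scalarHom p 2 v₂, hs₂, h * s₃, H₃.mul_mem (hHK hh) hs₃, ?_⟩
  rw [← hprod, ← map_mul, ← mul_assoc, ← mul_assoc, scalarHom_comm (v₁ * v₂) h]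

/-! ## The large `p`-free member criterion -/

/-- **LARGE `p`-FREE MEMBER ⇒ NO LEVEL-ONE IDENTITY DESIGN, member `H₁`.**  Scalar parts cover
`Z`, `H ≤ H₁`, `p ∤ |H|`, `|H Z / Z| > p + 1` ⇒ no design.  All `p`; no TPP, no volume. -/
theorem no_levelOne_design_of_large_pfree_mem₁ {H₁ H₂ H₃ : Subgroup (GLm p 2)}
    (H : Subgroup (GLm p 2)) (hHK : H ≤ H₁)
    (hcover : ∀ z ∈ (scalarHom p 2).range, ∃ s₁ ∈ H₁ ⊓ (scalarHom p 2).range,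
      ∃ s₂ ∈ H₂ ⊓ (scalarHom p 2).range, ∃ s₃ ∈ H₃ ⊓ (scalarHom p 2).range, s₁ * s₂ * s₃ = z)
    (hHp : ¬ p ∣ Nat.card H)
    (hbig : p + 1 < Nat.card (H.map (QuotientGroup.mk' (scalarHom p 2).range))) :
    ¬ ∃ c : Mat p 2 → ℂ, (∀ M, 1 < M.rank → c M = 0) ∧
      (∑ M, c M * ZMod.stdAddChar (Matrix.trace (M * ((1 : GLm p 2) : Mat p 2)))) = 1 ∧
      ∀ a ∈ H₁, ∀ b ∈ H₂, ∀ g ∈ H₃, a * b * g ≠ 1 →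
        (∑ M, c M *
          ZMod.stdAddChar (Matrix.trace (M * ((a * b * g : GLm p 2) : Mat p 2)))) = 0 :=
  no_levelOne_design_of_large_pfree_prod _ (prod_mem_of_cover₁ H hHK hcover)
    (not_dvd_card_comap_map_mk H hHp) (card_comap_map_mk_gt H hbig)

/-- **LARGE `p`-FREE MEMBER ⇒ NO LEVEL-ONE IDENTITY DESIGN, member `H₂`.** -/
theorem no_levelOne_design_of_large_pfree_mem₂ {H₁ H₂ H₃ : Subgroup (GLm p 2)}
    (H : Subgroup (GLm p 2)) (hHK : H ≤ H₂)
    (hcover : ∀ z ∈ (scalarHom p 2).range, ∃ s₁ ∈ H₁ ⊓ (scalarHom p 2).range,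
      ∃ s₂ ∈ H₂ ⊓ (scalarHom p 2).range, ∃ s₃ ∈ H₃ ⊓ (scalarHom p 2).range, s₁ * s₂ * s₃ = z)
    (hHp : ¬ p ∣ Nat.card H)
    (hbig : p + 1 < Nat.card (H.map (QuotientGroup.mk' (scalarHom p 2).range))) :
    ¬ ∃ c : Mat p 2 → ℂ, (∀ M, 1 < M.rank → c M = 0) ∧
      (∑ M, c M * ZMod.stdAddChar (Matrix.trace (M * ((1 : GLm p 2) : Mat p 2)))) = 1 ∧
      ∀ a ∈ H₁, ∀ b ∈ H₂, ∀ g ∈ H₃, a * b * g ≠ 1 →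
        (∑ M, c M *
          ZMod.stdAddChar (Matrix.trace (M * ((a * b * g : GLm p 2) : Mat p 2)))) = 0 :=
  no_levelOne_design_of_large_pfree_prod _ (prod_mem_of_cover₂ H hHK hcover)
    (not_dvd_card_comap_map_mk H hHp) (card_comap_map_mk_gt H hbig)

/-- **LARGE `p`-FREE MEMBER ⇒ NO LEVEL-ONE IDENTITY DESIGN, member `H₃`.** -/
theorem no_levelOne_design_of_large_pfree_mem₃ {H₁ H₂ H₃ : Subgroup (GLm p 2)}
    (H : Subgroup (GLm p 2)) (hHK : H ≤ H₃)
    (hcover : ∀ z ∈ (scalarHom p 2).range, ∃ s₁ ∈ H₁ ⊓ (scalarHom p 2).range,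
      ∃ s₂ ∈ H₂ ⊓ (scalarHom p 2).range, ∃ s₃ ∈ H₃ ⊓ (scalarHom p 2).range, s₁ * s₂ * s₃ = z)
    (hHp : ¬ p ∣ Nat.card H)
    (hbig : p + 1 < Nat.card (H.map (QuotientGroup.mk' (scalarHom p 2).range))) :
    ¬ ∃ c : Mat p 2 → ℂ, (∀ M, 1 < M.rank → c M = 0) ∧
      (∑ M, c M * ZMod.stdAddChar (Matrix.trace (M * ((1 : GLm p 2) : Mat p 2)))) = 1 ∧
      ∀ a ∈ H₁, ∀ b ∈ H₂, ∀ g ∈ H₃, a * b * g ≠ 1 →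
        (∑ M, c M *
          ZMod.stdAddChar (Matrix.trace (M * ((a * b * g : GLm p 2) : Mat p 2)))) = 0 :=
  no_levelOne_design_of_large_pfree_prod _ (prod_mem_of_cover₃ H hHK hcover)
    (not_dvd_card_comap_map_mk H hHp) (card_comap_map_mk_gt H hbig)

/-- **TPP form, member `H₁`.**  For a subgroup-TPP triple with full scalar parts
`|S₁||S₂||S₃| = p - 1`, a `p`-free `H ≤ H₁` with `|H Z / Z| > p + 1` kills every level-one
identity design. -/
theorem no_levelOne_design_of_large_pfree_tpp₁ {H₁ H₂ H₃ : Subgroup (GLm p 2)}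
    (htpp : Literature.Barriers.MatrixMultiplication.SubgroupTPP H₁ H₂ H₃)
    (hfull : Nat.card (H₁.comap (scalarHom p 2)) * Nat.card (H₂.comap (scalarHom p 2)) *
      Nat.card (H₃.comap (scalarHom p 2)) = p - 1)
    (H : Subgroup (GLm p 2)) (hHK : H ≤ H₁) (hHp : ¬ p ∣ Nat.card H)
    (hbig : p + 1 < Nat.card (H.map (QuotientGroup.mk' (scalarHom p 2).range))) :
    ¬ ∃ c : Mat p 2 → ℂ, (∀ M, 1 < M.rank → c M = 0) ∧
      (∑ M, c M * ZMod.stdAddChar (Matrix.trace (M * ((1 : GLm p 2) : Mat p 2)))) = 1 ∧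
      ∀ a ∈ H₁, ∀ b ∈ H₂, ∀ g ∈ H₃, a * b * g ≠ 1 →
        (∑ M, c M *
          ZMod.stdAddChar (Matrix.trace (M * ((a * b * g : GLm p 2) : Mat p 2)))) = 0 :=
  no_levelOne_design_of_large_pfree_mem₁ H hHK (scalar_cover htpp hfull) hHp hbig

end LargePfreeMember

end Summit.MatrixMultiplication.MatrixMultiplication.Theorems.SubgroupIdentityDesigns.Negative
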